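import Mathlib
import HarnessLib

/-!
# Interleaved randomized benchmarking: the printed estimator and error interval
# (Magesan et al., PRL 109, 080505)

Topic `Computability/QuantumAlgorithms`.  PUBLISHED FORMULAS with our (elementary) proofs of their
algebraic properties; three definitions (the printed closed forms) and NO named fact (`def … : Prop`)
(D-0026).  Mathlib ∕ Literature had no randomized-benchmarking statement (`lean search 'randomized
benchmarking'`, `'interleaved'`: nothing relevant).

HONEST FRAMING: instance-level adjudication of specific advantage claims; no claim about BQP vs BPP
or the summit.

## Source (read on the materialised text) and what is taken

E. Magesan, J. M. Gambetta, B. R. Johnson, C. A. Ryan, J. M. Chow, S. T. Merkel, M. P. da Silva,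
G. A. Keefe, M. B. Rothwell, T. A. Ohki, M. B. Ketchen, M. Steffen, *Efficient measurement of quantum
gate error by interleaved randomized benchmarking*, Phys. Rev. Lett. **109**, 080505 (2012) =
arXiv:1203.4550 [MagesanEtAl2012InterleavedRB] (held text `paper:arxiv-1203.4550`, chunk p0003 =
the protocol, Steps 1–3).  Step 1: the fit "gives the depolarizing parameter `p` (the average error
rate over all Clifford gates is given by `r = (d-1)(1-p)/d`), where `d = 2^n` is the dimension of the
system."  Step 3: "From the values obtained for `p` (Step 1) and `p_C̄` (Step 2), the gate error of
`Λ_C` … is estimated by `r_C^est = (d-1)(1 - p_C̄/p)/d`, and must lie in the range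
`[r_C^est - E, r_C^est + E]` where
`E = min{ (d-1)[|p - p_C̄/p| + (1-p)]/d , 2(d²-1)(1-p)/(p d²) + 4√(1-p)√(d²-1)/p }`."  After the
equation: "in the limit of perfect random gates, `p → 1`, `r_C^est` goes to the standard error for a
depolarizing channel with strength `p_C` …, and `E` goes to zero."

## What is formalised (real parameters `d`, `p`, `p_C̄`; no probability, no channels)

* `rbError d p = (d-1)(1-p)/d` (def, Step 1), `irbEstimate d p pC = (d-1)(1 - pC/p)/d` (def, Step 3),
  `irbErrorBound d p pC = min{…, …}` (def, the printed `E`);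
* `rbError_eq_zero_iff`, `depolarizing_eq_of_rbError` (`p = 1 - d·r/(d-1)`), `irbEstimate_eq_rbError_div`
  (`r_C^est` is the RB error of the ratio `p_C̄/p`);
* **`irbEstimate_eq_sub_div`** — the estimator written in the two measured ERROR RATES
  `r = rbError d p`, `r̄ = rbError d p_C̄`:  `r_C^est = (r̄ - r)/(1 - d·r/(d-1))`, i.e. the form
  `((d-1)/d)·(1 - (1 - d r̄/(d-1))/(1 - d r/(d-1)))` in which device papers quote it;
* **`irbEstimate_one`**, **`irbErrorBound_one`** — the printed limit statements at `p = 1`: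
  `r_C^est = rbError d p_C̄` and `E = 0` (for `d ≥ 1`);
* `irbErrorBound_nonneg` (for `0 < p ≤ 1`, `d ≥ 1`), `irbErrorBound_le_first`, `irbErrorBound_le_second`.

NOT formalised: the derivation of `E` from the composed-channel fidelity bounds (the Letter's
supplementary argument), the Pauli-channel refinement `2(d²-1)(1-p)/(pd²)`, the fitting models
`F_seq^{(0)}`, `F_seq^{(1)}`, and anything about actual channels (average gate fidelity, twirling).

Context (cell pub-qadeq): the interleaved-RB identity is the accounting step behind the hardware rows
that quote "error per two-qubit Clifford `r`, interleaved `r̄` ⇒ error per gate" (e.g. CLAIMS A-1562,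
ETH multi-module processor: `d = 4`, `r = 1.34e-2`, `r̄ = 2.02e-2` ⇒ `7.0(5)e-3`; the private
`irbEstimate_eth_example` below checks that printed rounding in the kernel).
-/

noncomputable section

namespace Literature.Computability.QuantumAlgorithms.InterleavedRB

/-- Step 1: the average error rate over the Clifford group from the depolarizing parameter `p` of the
reference decay, `r = (d − 1)(1 − p)/d` (`d = 2^n`). [cite: MagesanEtAl2012InterleavedRB, Step 1 (p.2)] -/
def rbError (d p : ℝ) : ℝ := (d - 1) * (1 - p) / d

/-- Step 3: the interleaved-RB point estimate of the gate error,
`r_C^est = (d − 1)(1 − p_C̄/p)/d`. [cite: MagesanEtAl2012InterleavedRB, Step 3 eq. for r_C^est (p.2)] -/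
def irbEstimate (d p pC : ℝ) : ℝ := (d - 1) * (1 - pC / p) / d

/-- Step 3: the half-width `E` of the printed interval `[r_C^est − E, r_C^est + E]`,
`E = min{ (d−1)[|p − p_C̄/p| + (1−p)]/d , 2(d²−1)(1−p)/(p d²) + 4√(1−p)√(d²−1)/p }`.
[cite: MagesanEtAl2012InterleavedRB, Step 3 eq. for E (p.2)] -/
def irbErrorBound (d p pC : ℝ) : ℝ :=
  min ((d - 1) * (|p - pC / p| + (1 - p)) / d)
    (2 * (d ^ 2 - 1) * (1 - p) / (p * d ^ 2) + 4 * Real.sqrt (1 - p) * Real.sqrt (d ^ 2 - 1) / p)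

/-- Unfolding `r = (d − 1)(1 − p)/d`. [cite: MagesanEtAl2012InterleavedRB, Step 1 (p.2)] -/
theorem rbError_def (d p : ℝ) : rbError d p = (d - 1) * (1 - p) / d := rfl

/-- Unfolding `r_C^est = (d − 1)(1 − p_C̄/p)/d`. [cite: MagesanEtAl2012InterleavedRB, Step 3 (p.2)] -/
theorem irbEstimate_def (d p pC : ℝ) : irbEstimate d p pC = (d - 1) * (1 - pC / p) / d := rfl

/-- For `d ∉ {0, 1}` the RB error vanishes exactly when the decay is trivial, `p = 1`.
[cite: MagesanEtAl2012InterleavedRB, Step 1 (p.2)] -/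
theorem rbError_eq_zero_iff {d p : ℝ} (hd0 : d ≠ 0) (hd1 : d ≠ 1) :
    rbError d p = 0 ↔ p = 1 := by
  unfold rbError
  have h1 : d - 1 ≠ 0 := sub_ne_zero.mpr hd1
  constructor
  · intro h
    rw [div_eq_zero_iff] at h
    rcases h with h | h
    · rcases mul_eq_zero.mp h with h | h
      · exact absurd h h1
      · linarith
    · exact absurd h hd0
  · intro h
    rw [h]
    simp

/-- The depolarizing parameter recovered from the error rate: `p = 1 − d·r/(d − 1)` (`d ≠ 0, 1`).
[cite: MagesanEtAl2012InterleavedRB, Step 1 (p.2)] -/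
theorem depolarizing_eq_of_rbError {d : ℝ} (hd0 : d ≠ 0) (hd1 : d ≠ 1) (p : ℝ) :
    p = 1 - d * rbError d p / (d - 1) := by
  unfold rbError
  have h1 : d - 1 ≠ 0 := sub_ne_zero.mpr hd1
  field_simp
  ring

/-- `r_C^est` is the RB error rate of the RATIO of the two depolarizing parameters:
`r_C^est(d, p, p_C̄) = r(d, p_C̄/p)`. [cite: MagesanEtAl2012InterleavedRB, Step 3 (p.2)] -/
theorem irbEstimate_eq_rbError_div (d p pC : ℝ) : irbEstimate d p pC = rbError d (pC / p) := rfl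

/-- **The estimator in terms of the two measured error rates.** With `r = rbError d p` (reference) and
`r̄ = rbError d p_C̄` (interleaved), for `p ≠ 0` and `d ≠ 0, 1`:
`r_C^est = (r̄ − r)/(1 − d·r/(d − 1))` — equivalently `((d−1)/d)·(1 − (1 − d r̄/(d−1))/(1 − d r/(d−1)))`,
since `1 − d·r/(d−1) = p` and `1 − d·r̄/(d−1) = p_C̄`. [cite: MagesanEtAl2012InterleavedRB, Step 3 (p.2)] -/
theorem irbEstimate_eq_sub_div {d p : ℝ} (hd0 : d ≠ 0) (hd1 : d ≠ 1) (hp : p ≠ 0) (pC : ℝ) :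
    irbEstimate d p pC = (rbError d pC - rbError d p) / (1 - d * rbError d p / (d - 1)) := by
  have h1 : d - 1 ≠ 0 := sub_ne_zero.mpr hd1
  have hden : 1 - d * rbError d p / (d - 1) = p := by
    unfold rbError; field_simp; ring
  have hnum : rbError d pC - rbError d p = (d - 1) * (p - pC) / d := by
    unfold rbError; field_simp; ring
  rw [hden, hnum]
  unfold irbEstimate
  field_simp

/-- The same identity with the error rates as the primary data: if `p = 1 − d r/(d−1)` and
`p_C̄ = 1 − d r̄/(d−1)` then `r_C^est = ((d−1)/d)·(1 − p_C̄/p) = (r̄ − r)/(1 − d r/(d−1))`.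
[cite: MagesanEtAl2012InterleavedRB, Step 3 (p.2)] -/
theorem irbEstimate_of_errorRates {d r rbar : ℝ} (hd0 : d ≠ 0) (hd1 : d ≠ 1)
    (hp : 1 - d * r / (d - 1) ≠ 0) :
    irbEstimate d (1 - d * r / (d - 1)) (1 - d * rbar / (d - 1)) = (rbar - r) / (1 - d * r / (d - 1)) := by
  have h1 : d - 1 ≠ 0 := sub_ne_zero.mpr hd1
  generalize hq : 1 - d * r / (d - 1) = q at hp ⊢
  have hpc : 1 - d * rbar / (d - 1) = q - d * (rbar - r) / (d - 1) := by rw [← hq]; ring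
  rw [hpc]
  unfold irbEstimate
  field_simp
  ring

/-- "In the limit of perfect random gates, `p → 1`, `r_C^est` goes to the standard error for a
depolarizing channel with strength `p_C`": at `p = 1`, `r_C^est = r(d, p_C̄)`.
[cite: MagesanEtAl2012InterleavedRB, Step 3, sentence after the equation for E (p.2)] -/
theorem irbEstimate_one (d pC : ℝ) : irbEstimate d 1 pC = rbError d pC := by
  unfold irbEstimate rbError
  rw [div_one]

/-- `E` is at most its first branch. [cite: MagesanEtAl2012InterleavedRB, Step 3 eq. for E (p.2)] -/
theorem irbErrorBound_le_first (d p pC : ℝ) :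
    irbErrorBound d p pC ≤ (d - 1) * (|p - pC / p| + (1 - p)) / d :=
  min_le_left _ _

/-- `E` is at most its second branch. [cite: MagesanEtAl2012InterleavedRB, Step 3 eq. for E (p.2)] -/
theorem irbErrorBound_le_second (d p pC : ℝ) :
    irbErrorBound d p pC
      ≤ 2 * (d ^ 2 - 1) * (1 - p) / (p * d ^ 2) + 4 * Real.sqrt (1 - p) * Real.sqrt (d ^ 2 - 1) / p :=
  min_le_right _ _

/-- `E ≥ 0` whenever `0 < p ≤ 1` and `d ≥ 1` (both branches are then non-negative).
[cite: MagesanEtAl2012InterleavedRB, Step 3 eq. for E (p.2)] -/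
theorem irbErrorBound_nonneg {d p : ℝ} (hd : 1 ≤ d) (hp0 : 0 < p) (hp1 : p ≤ 1) (pC : ℝ) :
    0 ≤ irbErrorBound d p pC := by
  unfold irbErrorBound
  have hd0 : 0 < d := by linarith
  have hd2 : 0 ≤ d ^ 2 - 1 := by nlinarith
  refine le_min ?_ ?_
  · apply div_nonneg _ hd0.le
    apply mul_nonneg (by linarith)
    have := abs_nonneg (p - pC / p)
    linarith
  · apply add_nonneg
    · apply div_nonneg
      · apply mul_nonneg (mul_nonneg (by norm_num) hd2); linarith
      · positivity
    · apply div_nonneg _ hp0.le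
      exact mul_nonneg (mul_nonneg (by norm_num) (Real.sqrt_nonneg _)) (Real.sqrt_nonneg _)

/-- "… and `E` goes to zero": at `p = 1` the second branch vanishes, so `E = 0` (for `d ≥ 1`, where the
first branch `(d−1)|1 − p_C̄|/d` is non-negative).
[cite: MagesanEtAl2012InterleavedRB, Step 3, sentence after the equation for E (p.2)] -/
theorem irbErrorBound_one {d : ℝ} (hd : 1 ≤ d) (pC : ℝ) : irbErrorBound d 1 pC = 0 := by
  unfold irbErrorBound
  have hd0 : 0 < d := by linarith
  have h2 : (2 * (d ^ 2 - 1) * (1 - (1 : ℝ)) / (1 * d ^ 2)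
      + 4 * Real.sqrt (1 - (1 : ℝ)) * Real.sqrt (d ^ 2 - 1) / 1) = 0 := by
    simp
  rw [h2]
  apply min_eq_right
  apply div_nonneg _ hd0.le
  apply mul_nonneg (by linarith)
  have := abs_nonneg ((1 : ℝ) - pC / 1)
  linarith

/-- The cell's worked instance (context only): with `d = 4` and the printed two-qubit Clifford error
rates `r = 1.34e-2` (reference) and `r̄ = 2.02e-2` (interleaved) of the ETH multi-module processor,
the estimator gives `51∕7366 = 0.006924…`, which prints as the paper's `7.0e-3` (to the printed
`0.5e-3`). [cite: NorrisEtAl2026MultiModuleProcessorEPJQT, §5 (two-qubit RB ∕ IRB: 1.34(3)e-2,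
2.02(4)e-2 ⇒ 7.0(5)e-3)] -/
private theorem irbEstimate_eth_example :
    irbEstimate 4 (1 - 4 * (134 / 10000) / (4 - 1)) (1 - 4 * (202 / 10000) / (4 - 1)) = 51 / 7366 ∧
      |(51 / 7366 : ℝ) - 7 / 1000| < 5 / 10000 := by
  constructor
  · unfold irbEstimate
    norm_num
  · norm_num [abs_of_neg]

end Literature.Computability.QuantumAlgorithms.InterleavedRB

end
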